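import Literature.Computability.AlgebraicComplexity.PolynomialKoszulYoungFlatteningHilbertBound
import Literature.Barriers.ValiantsHypothesis.ShiftedPartialsDegenerations
import Literature.Barriers.ValiantsHypothesis.ShiftedPartialsPermanentSide
import HarnessLib
import HarnessLib.Audit

/-!
# `GCT/Max`: S-F-6 permanent side — no-syzygy upper bounds for the Koszul–Young ranks of the padded `3 × 3` permanent

Cell `pub-gct-max` (HOME `run/shared/lean/pub/pub-gct-max/`), track F, Lean port S-F-6 of the located negative C-F-3′ / N-F-1
(lead D53/D65; referee read 2026-08-23T04:57:52Z, no objection). THIS MODULE = the permanent-side layer, written and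
kernel-checked by theory-2 (`lean-scratch/SF6Assembly.lean` sha256/16 `070a324692f9b2dc`, namespace `SF6Leibniz` and the
discharges `hypBound_holds` / `hypBoundHigh_holds` / `hypZero_holds`), re-homed under the inter-cell NAMING RULE
(`Summits/PneNP/GCT/Max/`) by lit-2 with docstrings; mathematics: memo `CF3-THEOREM.md` §1, S-F-6-STATEMENTS (ii)
(theory-2). Everything PROVED; no conjecture of the cell is used or asserted. HONEST FRAMING: multiplicity data and
certified rank bounds at small parameters; occurrence obstructions are ruled out in print (BIP'16) — multiplicity obstructions
are the open door; nothing here is a claim on VP vs VNP or P vs NP.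

**Contents.** With `Ssum k = Σ_{j ≤ k} C(3,j)²` (the tree-form bound on the number of order-`j` partials of `per₃`) and
`boundS N p k = min (Ssum k · C(N,p)) (Ssum (k+1) · C(N,p+1))`:
* `SF6Leibniz.iterPDeriv_X_pow_mul_mem_filter`, `SF6Leibniz.shiftedPartialsRank_zero_X_pow_mul_le_filter` — the refined
  Leibniz bound `h_{y^a·w}(k) ≤ Σ_{j ≤ k, k-j ≤ a} h_w(j)` (any field, any `w`; the tree's `shiftedPartialsRank_zero_X_pow_mul_le`
  drops the constraint `k - j ≤ a`), `…_paddedPerPoly_three_le_filter`, and the reindexing `sum_filter_choose_sq_le`;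
* `kyRankFin_eq_zero_of_isHomogeneous` (`KY_{p,k}(f) = 0` for a form of degree `≤ k`);
* the three bounds for `Q_n = X₀₀^{n-3}·per₃` (`n ≥ 3`, all `p, k`): `kyRank_paddedPerPoly_three_le_boundS`
  (`rank KY_{p,k}(Q_n) ≤ boundS n² p k`, from lit-2's `kyRank_le_shiftedPartialsRank_mul_choose` + the tree's
  `shiftedPartialsRank_paddedPerPoly_le_sum_mul`), `kyRank_paddedPerPoly_three_le_high` (the HIGH-order form
  `≤ min (Ssum (n-k)·C(n²,p)) (Ssum (n-k-1)·C(n²,p+1))`, WITHOUT transpose duality), `kyRank_paddedPerPoly_three_eq_zero`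
  (`k ≥ n`); packaged as `PaddedPerThreeKYUpperBounds` with `paddedPerThreeKYUpperBounds_holds`.
-/

noncomputable section

namespace Summit.PneNP.GCT

namespace SF6Stage3

open Finset

/-- Tree-form partials bound `Σ_{j ≤ k} C(3,j)²` (= the `shiftedPartialsRank` bound of the padded `per₃`). [folklore] -/
def Ssum (k : ℕ) : ℕ := ∑ j ∈ range (k + 1), (Nat.choose 3 j) ^ 2

/-- No-syzygy bound of the padded side at cell `(p,k)` in `N = n²` variables:
`min (Ssum k · C(N,p)) (Ssum (k+1) · C(N,p+1))`. [folklore] -/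
def boundS (N p k : ℕ) : ℕ := min (Ssum k * N.choose p) (Ssum (k + 1) * N.choose (p + 1))

end SF6Stage3

/-! ## Refined Leibniz bound for padded forms: `h_{y^a w}(k) ≤ Σ_{j ≤ k, k - j ≤ a} h_w(j)`
(the tree's `shiftedPartialsRank_zero_X_pow_mul_le` drops the constraint `k - j ≤ a`; keeping it gives the
high-order bound `h_{X₀₀^{n-3} per₃}(k) ≤ S_{n-k}` WITHOUT Hilbert-function symmetry or transpose duality). -/

namespace SF6Leibniz

open MvPolynomial Literature.Barriers.ValiantsHypothesis Literature.Computability.AlgebraicComplexity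

variable {K : Type*} [Field K] {σ : Type*} [DecidableEq σ]

/-- `∂^l (X i₀ ^ a · w) ∈ Σ_{j ≤ |l|, |l| - j ≤ a} X i₀ ^ (a - (|l| - j)) · ⟨∂^j w⟩` (Leibniz, keeping the
constraint that `X i₀ ^ a` can be differentiated at most `a` times). [folklore] -/
theorem iterPDeriv_X_pow_mul_mem_filter (i₀ : σ) (a : ℕ) (w : MvPolynomial σ K) (l : List σ) :
    iterPDeriv l (X i₀ ^ a * w) ∈
      ((Finset.range (l.length + 1)).filter (fun j => l.length ≤ a + j)).sup fun j =>
        (Submodule.span K (derivSet j w)).map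
          (LinearMap.mulLeft K ((X i₀ : MvPolynomial σ K) ^ (a - (l.length - j)))) := by
  classical
  induction l with
  | nil =>
    set G : ℕ → Submodule K (MvPolynomial σ K) := fun j => (Submodule.span K (derivSet j w)).map
      (LinearMap.mulLeft K ((X i₀ : MvPolynomial σ K) ^ (a - (([] : List σ).length - j)))) with hG
    have hmem : (0 : ℕ) ∈ (Finset.range (([] : List σ).length + 1)).filter
        (fun j => ([] : List σ).length ≤ a + j) := by simp
    refine (Finset.le_sup (f := G) hmem) ?_
    refine ⟨w, Submodule.subset_span ⟨[], rfl, rfl⟩, ?_⟩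
    simp
  | cons i l ih =>
    rw [iterPDeriv_cons, List.length_cons]
    set F : ℕ → Submodule K (MvPolynomial σ K) := fun j => (Submodule.span K (derivSet j w)).map
      (LinearMap.mulLeft K ((X i₀ : MvPolynomial σ K) ^ (a - (l.length - j)))) with hF
    set G : ℕ → Submodule K (MvPolynomial σ K) := fun j => (Submodule.span K (derivSet j w)).map
      (LinearMap.mulLeft K ((X i₀ : MvPolynomial σ K) ^ (a - (l.length + 1 - j)))) with hG
    set I : Finset ℕ := (Finset.range (l.length + 1 + 1)).filter (fun j => l.length + 1 ≤ a + j)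
      with hI
    have hstep : ∀ j ∈ (Finset.range (l.length + 1)).filter (fun j => l.length ≤ a + j),
        F j ≤ (I.sup G).comap (pderiv i).toLinearMap := by
      intro j hj
      rw [Finset.mem_filter, Finset.mem_range] at hj
      obtain ⟨hj1, hj2⟩ := hj
      rintro _ ⟨d, hd, rfl⟩
      rw [Submodule.mem_comap]
      change pderiv i ((X i₀ : MvPolynomial σ K) ^ (a - (l.length - j)) * d) ∈ _
      rw [pderiv_mul]
      refine Submodule.add_mem _ ?_ ?_
      · rw [Derivation.leibniz_pow, pderiv_X]
        by_cases hi : i₀ = i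
        · subst hi
          by_cases hb : a - (l.length - j) = 0
          · rw [hb]; simp
          · have hle : G j ≤ I.sup G :=
              Finset.le_sup (f := G) (Finset.mem_filter.2 ⟨Finset.mem_range.2 (by omega), by omega⟩)
            refine hle ⟨((a - (l.length - j) : ℕ) : K) • d, Submodule.smul_mem _ _ hd, ?_⟩
            simp only [LinearMap.mulLeft_apply, Pi.single_eq_same, smul_eq_mul, mul_one]
            rw [show a - (l.length + 1 - j) = a - (l.length - j) - 1 by omega, mul_smul_comm,
              ← smul_mul_assoc, ← Nat.cast_smul_eq_nsmul K]
        · have : (Pi.single (M := fun _ => MvPolynomial σ K) i 1 i₀) = 0 := by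
            rw [Pi.single_apply, if_neg hi]
          rw [this]; simp
      · have hle : G (j + 1) ≤ I.sup G :=
          Finset.le_sup (f := G) (Finset.mem_filter.2 ⟨Finset.mem_range.2 (by omega), by omega⟩)
        refine hle ⟨pderiv i d, ?_, ?_⟩
        · have : Submodule.span K (derivSet j w) ≤
              (Submodule.span K (derivSet (j + 1) w)).comap (pderiv i).toLinearMap := by
            rw [Submodule.span_le]
            rintro _ ⟨l', hl', rfl⟩
            simp only [SetLike.mem_coe, Submodule.mem_comap]
            exact Submodule.subset_span ⟨i :: l', by simp [hl'], by rw [iterPDeriv_cons]; rfl⟩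
          exact this hd
        · simp only [LinearMap.mulLeft_apply]
          rw [show a - (l.length + 1 - (j + 1)) = a - (l.length - j) by omega]
    have hsup : ((Finset.range (l.length + 1)).filter (fun j => l.length ≤ a + j)).sup F ≤
        (I.sup G).comap (pderiv i).toLinearMap :=
      Finset.sup_le fun j hj => hstep j hj
    exact hsup ih

/-- Hence `h_{X i₀ ^ a · w}(k) ≤ Σ_{j ≤ k, k - j ≤ a} h_w(j)`. [folklore] -/
theorem shiftedPartialsRank_zero_X_pow_mul_le_filter [Fintype σ] (i₀ : σ) (a : ℕ)
    (w : MvPolynomial σ K) (k : ℕ) :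
    shiftedPartialsRank K k 0 (X i₀ ^ a * w) ≤
      ∑ j ∈ (Finset.range (k + 1)).filter (fun j => k ≤ a + j), shiftedPartialsRank K j 0 w := by
  classical
  set G : ℕ → Submodule K (MvPolynomial σ K) := fun j => (Submodule.span K (derivSet j w)).map
    (LinearMap.mulLeft K ((X i₀ : MvPolynomial σ K) ^ (a - (k - j)))) with hG
  haveI : ∀ j, Module.Finite K (Submodule.span K (derivSet j w)) := fun j => by
    rw [← shiftedPartials_zero_right]; exact finite_span_shiftedPartials j 0 w
  have h1 : Submodule.span K (derivSet k (X i₀ ^ a * w)) ≤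
      ((Finset.range (k + 1)).filter (fun j => k ≤ a + j)).sup G := by
    rw [Submodule.span_le]
    rintro _ ⟨l, hl, rfl⟩
    have := iterPDeriv_X_pow_mul_mem_filter (K := K) i₀ a w l
    rw [hl] at this
    exact this
  rw [shiftedPartialsRank_zero_eq]
  calc Module.finrank K (Submodule.span K (derivSet k (X i₀ ^ a * w)))
      ≤ Module.finrank K ↥(((Finset.range (k + 1)).filter (fun j => k ≤ a + j)).sup G) :=
        Submodule.finrank_mono h1
    _ ≤ ∑ j ∈ (Finset.range (k + 1)).filter (fun j => k ≤ a + j), Module.finrank K (G j) :=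
        finrank_finset_sup_le_sum _ G
    _ ≤ ∑ j ∈ (Finset.range (k + 1)).filter (fun j => k ≤ a + j), shiftedPartialsRank K j 0 w :=
        Finset.sum_le_sum fun j _ => by
          rw [shiftedPartialsRank_zero_eq]; exact Submodule.finrank_map_le _ _

/-- The padded `3 × 3` permanent: `h(k) ≤ Σ_{j ≤ k, k - j ≤ n - 3} C(3,j)²`. [folklore] -/
theorem shiftedPartialsRank_paddedPerPoly_three_le_filter (n : ℕ) [NeZero n] (hn : 3 ≤ n) (k : ℕ) :
    shiftedPartialsRank ℂ k 0 (paddedPerPoly ℂ 3 n) ≤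
      ∑ j ∈ (Finset.range (k + 1)).filter (fun j => k ≤ (n - 3) + j), (Nat.choose 3 j) ^ 2 := by
  classical
  rw [paddedPerPoly]
  refine (shiftedPartialsRank_zero_X_pow_mul_le_filter _ _ _ k).trans ?_
  exact Finset.sum_le_sum fun j _ => shiftedPartialsRank_zero_blockPer_le hn j

/-- Reindexing `j ↦ 3 - j`: `Σ_{j ≤ k, k - j ≤ a} C(3,j)² ≤ Σ_{i ≤ a + 3 - k} C(3,i)²`. [folklore] -/
theorem sum_filter_choose_sq_le (k a : ℕ) :
    ∑ j ∈ (Finset.range (k + 1)).filter (fun j => k ≤ a + j), (Nat.choose 3 j) ^ 2 ≤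
      ∑ i ∈ Finset.range (a + 3 - k + 1), (Nat.choose 3 i) ^ 2 := by
  classical
  set S := (Finset.range (k + 1)).filter (fun j => k ≤ a + j) with hS
  have h1 : ∑ j ∈ S, (Nat.choose 3 j) ^ 2 = ∑ j ∈ S.filter (fun j => j ≤ 3), (Nat.choose 3 j) ^ 2 := by
    refine (Finset.sum_filter_of_ne (s := S) (p := fun j => j ≤ 3) (fun j _ hne => ?_)).symm
    by_contra hj
    exact hne (by rw [Nat.choose_eq_zero_of_lt (by omega)]; simp)
  have h2 : ∑ j ∈ S.filter (fun j => j ≤ 3), (Nat.choose 3 j) ^ 2 =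
      ∑ j ∈ S.filter (fun j => j ≤ 3), (Nat.choose 3 (3 - j)) ^ 2 := by
    refine Finset.sum_congr rfl fun j hj => ?_
    rw [Finset.mem_filter] at hj
    rw [Nat.choose_symm hj.2]
  have h3 : ∑ j ∈ S.filter (fun j => j ≤ 3), (Nat.choose 3 (3 - j)) ^ 2 =
      ∑ i ∈ (S.filter (fun j => j ≤ 3)).image (fun j => 3 - j), (Nat.choose 3 i) ^ 2 := by
    rw [Finset.sum_image]
    intro x hx y hy hxy
    rw [Finset.coe_filter, Set.mem_setOf_eq] at hx hy
    simp only at hxy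
    omega
  have h4 : (S.filter (fun j => j ≤ 3)).image (fun j => 3 - j) ⊆ Finset.range (a + 3 - k + 1) := by
    intro i hi
    rw [Finset.mem_image] at hi
    obtain ⟨j, hj, rfl⟩ := hi
    rw [Finset.mem_filter, hS, Finset.mem_filter, Finset.mem_range] at hj
    rw [Finset.mem_range]
    omega
  rw [h1, h2, h3]
  exact Finset.sum_le_sum_of_subset h4

end SF6Leibniz

/-! ## The permanent-side bounds (theory-2's discharges, as theorems) -/

namespace SF6PerSide

open Literature.Computability.AlgebraicComplexity

open MvPolynomial Literature.Barriers.ValiantsHypothesis in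
/-- `KY_{p,k}(f) = 0` for a form `f` of degree `d ≤ k`: each `∂_j ∂^l f` (`|l| = k`) is the derivative of a
constant. [folklore] -/
lemma kyRankFin_eq_zero_of_isHomogeneous {q d : ℕ} (p k : ℕ) (f : MvPolynomial (Fin q) ℂ)
    (hf : f.IsHomogeneous d) (hk : d ≤ k) : kyRankFin ℂ p k f = 0 := by
  classical
  rw [kyRankFin]
  have hspan : Submodule.span ℂ (kyImages p k f) = ⊥ := by
    rw [Submodule.span_eq_bot]
    rintro g ⟨l, S, hl, -, rfl⟩
    have hg : (iterPDeriv l f).IsHomogeneous 0 := by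
      have := isHomogeneous_iterPDeriv hf l
      rwa [hl, show d - k = 0 by omega] at this
    have hconst : iterPDeriv l f = C ((iterPDeriv l f).coeff 0) := by
      rw [← totalDegree_eq_zero_iff_eq_C]
      exact Nat.le_zero.mp hg.totalDegree_le
    have hzero : ∀ j, pderiv j (iterPDeriv l f) = 0 := fun j => by rw [hconst, pderiv_C]
    funext T
    rw [kyImage_apply]
    simp [hzero]
  rw [hspan, finrank_bot]

open MvPolynomial in
/-- Orders `k ≥ n` of the degree-`n` form `X₀₀^{n-3}·per₃` have `KY_{p,k} = 0`. [folklore] -/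
theorem kyRank_paddedPerPoly_three_eq_zero (n : ℕ) [NeZero n] (p k : ℕ) (hn : 3 ≤ n) (hk : n ≤ k) :
    kyRank ℂ p k (paddedPerPoly ℂ 3 n) = 0 := by
  rw [kyRank_def]
  exact kyRankFin_eq_zero_of_isHomogeneous p k _
    ((paddedPerPoly_isHomogeneous (k := ℂ) hn).rename_isHomogeneous) hk

open Literature.Barriers.ValiantsHypothesis in
/-- **Low-order no-syzygy bound**: `rank KY_{p,k}(X₀₀^{n-3}·per₃) ≤ boundS n² p k` (`n ≥ 3`) — lit-2's
`kyRank_le_shiftedPartialsRank_mul_choose` (+ `succ`) composed with the tree's `shiftedPartialsRank_paddedPerPoly_le_sum_mul`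
at shift `τ = 0` (S-F-6 (ii-a,b,c)). [folklore] -/
theorem kyRank_paddedPerPoly_three_le_boundS (n : ℕ) [NeZero n] (p k : ℕ) (hn : 3 ≤ n) :
    kyRank ℂ p k (paddedPerPoly ℂ 3 n) ≤ SF6Stage3.boundS (n * n) p k := by
  unfold SF6Stage3.boundS
  refine le_min ?_ ?_
  · refine (kyRank_le_shiftedPartialsRank_mul_choose p k _).trans ?_
    rw [Fintype.card_prod, Fintype.card_fin]
    refine Nat.mul_le_mul_right _ ?_
    have h := shiftedPartialsRank_paddedPerPoly_le_sum_mul (K := ℂ) (m := 3) (n := n) hn k 0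
    simpa [SF6Stage3.Ssum] using h
  · refine (kyRank_le_shiftedPartialsRank_succ_mul_choose p k _).trans ?_
    rw [Fintype.card_prod, Fintype.card_fin]
    refine Nat.mul_le_mul_right _ ?_
    have h := shiftedPartialsRank_paddedPerPoly_le_sum_mul (K := ℂ) (m := 3) (n := n) hn (k + 1) 0
    simpa [SF6Stage3.Ssum] using h

open Literature.Barriers.ValiantsHypothesis in
/-- **High-order no-syzygy bound** `h(k) ≤ S_{n-k}`: `rank KY_{p,k}(X₀₀^{n-3}·per₃) ≤
min (Ssum (n-k)·C(n²,p)) (Ssum (n-(k+1))·C(n²,p+1))` (`n ≥ 3`), from the refined Leibniz bound and the reindexing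
`j ↦ 3 - j` — no transpose duality and no Hilbert-function symmetry needed (theory-2). [folklore] -/
theorem kyRank_paddedPerPoly_three_le_high (n : ℕ) [NeZero n] (p k : ℕ) (hn : 3 ≤ n) :
    kyRank ℂ p k (paddedPerPoly ℂ 3 n) ≤
      min (SF6Stage3.Ssum (n - k) * (n * n).choose p)
        (SF6Stage3.Ssum (n - (k + 1)) * (n * n).choose (p + 1)) := by
  refine le_min ?_ ?_
  · refine (kyRank_le_shiftedPartialsRank_mul_choose p k _).trans ?_
    rw [Fintype.card_prod, Fintype.card_fin]
    refine Nat.mul_le_mul_right _ ?_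
    have h := (SF6Leibniz.shiftedPartialsRank_paddedPerPoly_three_le_filter n hn k).trans
      (SF6Leibniz.sum_filter_choose_sq_le k (n - 3))
    rw [show n - 3 + 3 - k = n - k by omega] at h
    simpa [SF6Stage3.Ssum] using h
  · refine (kyRank_le_shiftedPartialsRank_succ_mul_choose p k _).trans ?_
    rw [Fintype.card_prod, Fintype.card_fin]
    refine Nat.mul_le_mul_right _ ?_
    have h := (SF6Leibniz.shiftedPartialsRank_paddedPerPoly_three_le_filter n hn (k + 1)).trans
      (SF6Leibniz.sum_filter_choose_sq_le (k + 1) (n - 3))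
    rw [show n - 3 + 3 - (k + 1) = n - (k + 1) by omega] at h
    simpa [SF6Stage3.Ssum] using h


end SF6PerSide

/-! ## The packaged statement of this module (PROVED) -/

open Literature.Computability.AlgebraicComplexity Literature.Barriers.ValiantsHypothesis in
/-- **Permanent-side upper bounds for the padded `3 × 3` permanent** (`n ≥ 3`, all `p, k`): the low-order bound
`≤ boundS n² p k`, the high-order bound `≤ min (Ssum (n-k)·C(n²,p)) (Ssum (n-k-1)·C(n²,p+1))`, and vanishing for `k ≥ n`.
Statements of the cell (S-F-6 (ii); CF3-THEOREM §1), PROVED below; not published theorems. [folklore] -/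
def PaddedPerThreeKYUpperBounds : Prop :=
  ∀ (n : ℕ) [NeZero n] (p k : ℕ), 3 ≤ n →
    kyRank ℂ p k (paddedPerPoly ℂ 3 n) ≤ SF6Stage3.boundS (n * n) p k ∧
    kyRank ℂ p k (paddedPerPoly ℂ 3 n) ≤
      min (SF6Stage3.Ssum (n - k) * (n * n).choose p) (SF6Stage3.Ssum (n - (k + 1)) * (n * n).choose (p + 1)) ∧
    (n ≤ k → kyRank ℂ p k (paddedPerPoly ℂ 3 n) = 0)

/-- `PaddedPerThreeKYUpperBounds` holds. [folklore] -/
theorem paddedPerThreeKYUpperBounds_holds : PaddedPerThreeKYUpperBounds :=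
  fun n _ p k hn => ⟨SF6PerSide.kyRank_paddedPerPoly_three_le_boundS n p k hn,
    SF6PerSide.kyRank_paddedPerPoly_three_le_high n p k hn,
    fun hk => SF6PerSide.kyRank_paddedPerPoly_three_eq_zero n p k hn hk⟩

end Summit.PneNP.GCT
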